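import Mathlib
import Literature.NumberTheory.LFunctions.Zhang2022.Section4Statements
import Literature.NumberTheory.LFunctions.Zhang2022.Section4Lemma41
import HarnessLib

/-!
# Zhang (2022) §4, proof of Lemma 4.1 (p. 16, tex L907–L923): the four typed proof displays
# `F20Stieltjes` (Z22:§4.u003), `F20Bound` / `G20Bound` (Z22:§4.u005) and the deduction `Ded41`
# (Z22:Lem4.1.pf), kernel-checked

Topic `Literature/NumberTheory/LFunctions/Zhang2022` (Landau–Siegel adjudication tree;
verdict-neutral). Y. Zhang, *Discrete mean estimates and the Landau–Siegel zero*,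
arXiv:2211.02515v1 (2022) [Zhang2022LandauSiegel] — **an unrefereed manuscript under adjudication;
nothing in this file asserts or denies its Theorems 1–2 or says anything about Landau–Siegel zeros.**
Cell siegel-zhang (D-0069), layer L1, row `Section4Statements` (typer L1-t3; this discharge file: L1-t1).

Source text [Z22 p. 16, tex L907–L923]:

> *Proof [of Lemma 4.1].* By the Stieltjes integral we may write
> `F(s,ψ)²⁰ = 1 + ∫₁^{D⁸⁰} x^{s₀−s} d{X₁(x,ψ)}`. For `s ∈ Ω₁` and `1 ≤ x ≤ D⁸⁰` we have `|x^{s₀−s}| ≪ 𝓛`,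
> `|d/dx (x^{s₀−s})| ≪ x⁻¹𝓛⁴⁰⁶`. Hence, by partial integration,
> `|F(s,ψ)|²⁰ ≪ 1 + 𝓛⁴⁰⁶(|X₁(D⁸⁰,ψ)| + ∫₁^{D⁸⁰} |X₁(x,ψ)|x⁻¹dx)`. For `G(s,ψ)` an entirely analogous
> bound is valid. The result now follows by (3.4). □

The skeleton node `Skeleton.Lemma41` itself is a theorem of the tree (`Skeleton.lemma41_holds`, file
`Section4Lemma41`, sz-d14), proved from `Lemma41.norm_F20_le` in one stroke. That proof BY-PASSES the
four finer CLAIM nodes of `Section4Statements.lean` that type the displayed steps; they are PROVED here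
(cited BY NAME, not restated), re-using sz-d14's algebra (`Lemma41Holds.sum_pow_eq_sum_convPow`) and the
tree's partial integration (`Lemma41.norm_F20_le`, `Section4PartialIntegration`):

* `Section4.f20Stieltjes_holds : F20Stieltjes` — the identity
  `F(s,ψ)²⁰ = 1 + Σ_{1<n≤D⁸⁰} ν₂₀(n)ψ(n)n^{−s₀}·n^{s₀−s}` (the Stieltjes integral against the step
  function `X₁`, in its evaluated form as typed), for EVERY `D, χ, ψ, s`;
* `Section4.f20Bound_holds : F20Bound`, `Section4.g20Bound_holds : G20Bound` — the partial-integration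
  bounds with the implied constant `C = 1`, threshold `D ≥ ⌈e³²⌉`, for EVERY `ψ ∈ Ψ` (as printed: (3.4)
  enters only afterwards);
* `Section4.ded41_holds : Ded41` — the printed deduction "The result now follows by (3.4)" as a GENUINE
  edge `F20Bound → G20Bound → Skeleton.Lemma41`: with the antecedents' constants `C_F, C_G` and
  `ψ ∈ Ψ₁` (so (3.4) = `Skeleton.Ineq34` bounds the bracket by `𝓛¹¹⁷¹`), `|F|²⁰ ≤ 2C_F′𝓛¹⁵⁷⁷`,
  `|F| ≤ (2C_F′)^{1/20}𝓛^{1577/20} ≤ (2C_F′)^{1/20}𝓛⁷⁹` (`C′ = max C 1`; `1577/20 = 78.85 < 79`,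
  the tree's `Lemma41.exponent_lemma41`), likewise for `G`.

No new definitions, no named facts (D-0026), no numerics; unconditional (no Assumption (A)).

## References

* Y. Zhang, arXiv:2211.02515v1 (2022), §3 p. 7 (`F`, `G`, `ν₂₀`, `υ₂₀`, `X₁`, `X₂`, (3.4)),
  §4 Lemma 4.1 (proof) p. 16, tex L907–L923. [cite: Zhang2022LandauSiegel, §4 Lemma 4.1 (proof) p.16]
-/

noncomputable section

open Complex Real Finset MeasureTheory
open Literature.NumberTheory.LFunctions.Zhang2022
open Literature.NumberTheory.LFunctions.Zhang2022.Skeleton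
open Literature.NumberTheory.LFunctions.Zhang2022.Lemma41Holds

namespace Literature.NumberTheory.LFunctions.Zhang2022.Section4

/-! ## Small inputs -/

/-- `𝓛 ≥ K` eventually, for any fixed real `K` (`𝓛 = log D`, (2.1)).
[cite: Zhang2022LandauSiegel, §2 (2.1)] -/
private theorem forAllLarge_le_ell₁ (K : ℝ) : ForAllLarge fun D _ _ => K ≤ ell D := by
  refine ⟨⌈Real.exp K⌉₊, fun D _ χ hD _ _ => ?_⟩
  have hD' : Real.exp K ≤ D := le_trans (Nat.le_ceil _) (by exact_mod_cast hD)
  exact (Real.le_log_iff_exp_le (lt_of_lt_of_le (Real.exp_pos K) hD')).mpr hD'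

/-- The `k`-fold convolution power at `n = 1`: `a^{∗k}(1) = a(1)ᵏ` (so `ν₂₀(1) = ν(1)²⁰ = 1`, the
printed "`1 +`" of the Stieltjes display). [cite: Zhang2022LandauSiegel, §3 p. 7] -/
private theorem convPow_apply_one (a : ℕ → ℂ) : ∀ k : ℕ, convPow a k 1 = a 1 ^ k
  | 0 => by simp [convPow]
  | k + 1 => by
      simp only [convPow, LSeries.convolution_def, Nat.divisorsAntidiagonal_one, Finset.sum_singleton]
      rw [convPow_apply_one a k, pow_succ']

/-- `ν₂₀(1) = 1` (`ν(1) = χ(1) = 1`, `1 ≤ D⁴`). [cite: Zhang2022LandauSiegel, §3 p. 7] -/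
private theorem nu20_one {D : ℕ} [NeZero D] (χ : DirichletCharacter ℂ D) : nu20 χ 1 = 1 := by
  have h : nu20 χ 1 = convPow (trunc (D ^ 4) (nu χ)) 20 1 := rfl
  rw [h, convPow_apply_one]
  have h1 : trunc (D ^ 4) (nu χ) 1 = 1 := by
    have hD : 1 ≤ D ^ 4 := Nat.one_le_pow _ _ (Nat.pos_of_ne_zero (NeZero.ne D))
    simp only [trunc, if_pos hD, nu, Literature.NumberTheory.LFunctions.divisorSumChar_one]
  rw [h1, one_pow]

/-! ## Z22:§4.u003 — "By the Stieltjes integral, `F(s,ψ)²⁰ = 1 + ∫₁^{D⁸⁰} x^{s₀−s} d{X₁(x,ψ)}`" -/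

/-- **Z22:§4.u003 HOLDS** [Z22 p.16, tex L909] «By the Stieltjes integral we may write
`F(s,ψ)²⁰ = 1 + ∫₁^{D⁸⁰} x^{s₀−s} d{X₁(x,ψ)}`»: the node `Section4.F20Stieltjes` (the integral against the
step function `X₁` in evaluated form: `F(s,ψ)²⁰ = 1 + Σ_{1<n≤D⁸⁰} ν₂₀(n)ψ(n)n^{−s₀}·n^{s₀−s}`), PROVED for
every `D, χ, ψ (mod p), s`: `F²⁰ = Σ_{n≤D⁸⁰} ν₂₀(n)ψ(n)n^{−s}` (`Lemma41Holds.sum_pow_eq_sum_convPow`, §3 (3.1)),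
the term `n = 1` is `ν₂₀(1) = 1`, and `n^{−s} = n^{−s₀}n^{s₀−s}`.
[cite: Zhang2022LandauSiegel, §4 Lemma 4.1 (proof) p.16] -/
theorem f20Stieltjes_holds : F20Stieltjes := by
  intro D _ χ x s
  -- `F = Σ_{n ≤ D⁴} (ν·1_{n≤D⁴})(n)ψ(n)n^{−s}`
  have htr : ∀ n, D ^ 4 < n → trunc (D ^ 4) (nu χ) n = 0 := fun n hn => by
    simp only [trunc, if_neg (not_le.mpr hn)]
  have hF : Fpoly χ x s =
      ∑ n ∈ Icc 1 (D ^ 4), trunc (D ^ 4) (nu χ) n * x.ψ (n : ZMod x.p) * (n : ℂ) ^ (-s) := by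
    refine Finset.sum_congr rfl fun n hn => ?_
    simp only [trunc, if_pos (Finset.mem_Icc.mp hn).2]
  -- its 20th power
  have hpow : Fpoly χ x s ^ 20 =
      ∑ n ∈ Icc 1 (D ^ 80), nu20 χ n * x.ψ (n : ZMod x.p) * (n : ℂ) ^ (-s) := by
    rw [hF, sum_pow_eq_sum_convPow x.ψ _ htr s 20, ← pow_mul]
    rfl
  -- split off `n = 1` and factor `n^{−s} = n^{−s₀}·n^{s₀−s}`
  have h80 : 1 ≤ D ^ 80 := Nat.one_le_pow _ _ (Nat.pos_of_ne_zero (NeZero.ne D))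
  rw [hpow, ← Finset.Ioc_insert_left h80, Finset.sum_insert (by simp), nu20_one]
  congr 1
  · simp
  · refine Finset.sum_congr rfl fun n hn => ?_
    have hn0 : (n : ℂ) ≠ 0 := by
      have := (Finset.mem_Ioc.mp hn).1
      exact_mod_cast (show n ≠ 0 by omega)
    rw [mul_assoc (nu20 χ n * x.ψ (n : ZMod x.p)) ((n : ℂ) ^ (-s0 D)), ← Complex.cpow_add _ _ hn0]
    congr 2
    ring

/-! ## Z22:§4.u005 — "Hence, by partial integration, `|F|²⁰ ≪ 1 + 𝓛⁴⁰⁶(|X₁(D⁸⁰)| + ∫₁^{D⁸⁰}|X₁|x⁻¹dx)`" -/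

/-- **The partial-integration bound for one twisted polynomial, any `ψ`** (the manuscript's display
tex L917 before (3.4) is applied): for `𝓛 = log D ≥ 32`, `s ∈ Ω₁`, coefficients `a`,
`a₂₀ = (a·1_{n≤D⁴})^{∗20}` and `X(y) = Σ_{n≤y} a₂₀(n)ψ(n)n^{−s₀}`:
`|Σ_{n≤D⁴} a(n)ψ(n)n^{−s}|²⁰ ≤ 𝓛⁴⁰⁶(|X(D⁸⁰)| + ∫₁^{D⁸⁰}|X(y)|dy/y)`. This is sz-d14's
`Lemma41Holds.norm_sum_le_rpow` (file `Section4Lemma41`) stopped before the (3.4) step: the 20th power is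
`Σ_{n≤D⁸⁰} a₂₀(n)ψ(n)n^{−s₀}·n^{s₀−s}`, and the tree's `Lemma41.norm_F20_le` bounds its modulus by
`𝓛^{4/5}|X(D⁸⁰)| + 𝓛⁴⁰⁶∫₁^{D⁸⁰}|X|dy/y`. [cite: Zhang2022LandauSiegel, §4 Lemma 4.1 (proof) p.16] -/
theorem norm_pow_twenty_le {D : ℕ} (hL : 32 ≤ ell D) {p : ℕ} (ψ : DirichletCharacter ℂ p)
    (a : ℕ → ℂ) {s : ℂ} (hs : s ∈ Omega1 D) (X : ℝ → ℂ)
    (hX : ∀ y : ℝ, X y = ∑ n ∈ Icc 1 ⌊y⌋₊,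
      convPow (trunc (D ^ 4) a) 20 n * ψ (n : ZMod p) * (n : ℂ) ^ (-s0 D)) :
    ‖∑ n ∈ Icc 1 (D ^ 4), a n * ψ (n : ZMod p) * (n : ℂ) ^ (-s)‖ ^ 20
      ≤ ell D ^ 406 * (‖X ((D : ℝ) ^ 80)‖ + ∫ y in (1 : ℝ)..(D : ℝ) ^ 80, ‖X y‖ / y) := by
  set L : ℝ := ell D with hLdef
  have hL1 : 1 ≤ L := by linarith
  have hL0 : 0 < L := by linarith
  -- `𝓛 = log D ≥ 32` forces `D > 1`
  have hD1 : (1 : ℝ) < D := by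
    by_contra h
    push Not at h
    have h' : Real.log (D : ℝ) ≤ 0 := Real.log_nonpos (Nat.cast_nonneg D) h
    have : L = Real.log (D : ℝ) := by rw [hLdef, ell]
    linarith
  have hD0 : (0 : ℝ) < D := by linarith
  -- the upper endpoint `b = D⁸⁰ = e^{80𝓛}`
  set b : ℝ := (D : ℝ) ^ 80 with hbdef
  have hb1 : 1 ≤ b := one_le_pow₀ hD1.le
  have hbX : b ≤ Real.exp (80 * L) := by
    have h : Real.exp (80 * L) = b := by
      rw [hLdef, ell, show (80 : ℝ) = ((80 : ℕ) : ℝ) by norm_num, Real.exp_nat_mul,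
        Real.exp_log hD0]
    rw [h]
  have hbfloor : ⌊b⌋₊ = D ^ 80 := by
    rw [hbdef, ← Nat.cast_pow, Nat.floor_natCast]
  -- `z = s₀ − s` on `Ω₁`
  set z : ℂ := s0 D - s with hzdef
  have hzre : z.re = 1 / 2 - s.re := by
    simp [hzdef, s0, SmoothWeight.s0_def]
  have hzim : z.im = 2 * Real.pi * t0 D - s.im := by
    simp [hzdef, s0, SmoothWeight.s0_def]
  have hs' : 1 / 2 - Real.log L / (100 * L) < s.re ∧ s.re < 1 + Real.log L / (100 * L) ∧
      |s.im - 2 * Real.pi * t0 D| < ell1 D + 5 := by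
    simpa only [Omega1, Lemma43.mem_Omega1_iff] using hs
  obtain ⟨h1, h2, h3⟩ := hs'
  have hz : z.re ≤ Real.log L / (100 * L) := by rw [hzre]; linarith
  have hη : Real.log L / (100 * L) ≤ 1 / 100 := by
    rw [div_le_div_iff₀ (by positivity) (by positivity)]
    nlinarith [Real.log_le_sub_one_of_pos hL0]
  have hre : |z.re| ≤ 1 := by
    rw [hzre, abs_le]
    constructor <;> linarith
  have him : |z.im| ≤ L ^ (405 : ℝ) + 5 := by
    rw [hzim, abs_sub_comm, show (405 : ℝ) = ((405 : ℕ) : ℝ) by norm_num, Real.rpow_natCast]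
    have : ell1 D = L ^ 405 := by rw [ell1, hLdef]
    linarith
  -- the coefficients `c(n) = a₂₀(n)ψ(n)n^{−s₀}`, `X = Xsum c 0`
  set c : ℕ → ℂ := fun n => convPow (trunc (D ^ 4) a) 20 n * ψ (n : ZMod p) * (n : ℂ) ^ (-s0 D)
    with hcdef
  have hXs : ∀ y : ℝ, Lemma41.Xsum c 0 y = X y := fun y => by
    rw [Lemma41.Xsum_zero, hX]
  -- Step 1: the sum is the twisted polynomial of the truncated coefficients
  have htr : ∀ n, D ^ 4 < n → trunc (D ^ 4) a n = 0 := fun n hn => by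
    simp only [trunc, if_neg (not_le.mpr hn)]
  have hsum : ∑ n ∈ Icc 1 (D ^ 4), a n * ψ (n : ZMod p) * (n : ℂ) ^ (-s) =
      ∑ n ∈ Icc 1 (D ^ 4), trunc (D ^ 4) a n * ψ (n : ZMod p) * (n : ℂ) ^ (-s) := by
    refine Finset.sum_congr rfl fun n hn => ?_
    simp only [trunc, if_pos (Finset.mem_Icc.mp hn).2]
  -- Step 2: its 20th power, with `n^{−s} = n^{−s₀}·n^{z}`
  have hpow : (∑ n ∈ Icc 1 (D ^ 4), a n * ψ (n : ZMod p) * (n : ℂ) ^ (-s)) ^ 20 =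
      ∑ n ∈ Icc 1 ⌊b⌋₊, c n * (n : ℂ) ^ z := by
    rw [hsum, sum_pow_eq_sum_convPow ψ _ htr s 20, ← pow_mul, hbfloor]
    refine Finset.sum_congr rfl fun n hn => ?_
    have hn0 : (n : ℂ) ≠ 0 := by
      have := (Finset.mem_Icc.mp hn).1
      exact_mod_cast (show n ≠ 0 by omega)
    simp only [hcdef, hzdef]
    rw [mul_assoc (_ * _) ((n : ℂ) ^ (-s0 D)), ← Complex.cpow_add _ _ hn0]
    congr 2
    ring
  -- Step 3: partial integration (tree)
  have key := Lemma41.norm_F20_le c hL hb1 hbX hz hre him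
  simp_rw [hXs] at key
  have hX0 : 0 ≤ ‖X b‖ := norm_nonneg _
  have h45 : L ^ (4 / 5 : ℝ) ≤ L ^ (406 : ℝ) :=
    Real.rpow_le_rpow_of_exponent_le hL1 (by norm_num)
  have h406 : L ^ (406 : ℝ) = L ^ 406 := by
    rw [show (406 : ℝ) = ((406 : ℕ) : ℝ) by norm_num, Real.rpow_natCast]
  calc ‖∑ n ∈ Icc 1 (D ^ 4), a n * ψ (n : ZMod p) * (n : ℂ) ^ (-s)‖ ^ 20
      = ‖(∑ n ∈ Icc 1 (D ^ 4), a n * ψ (n : ZMod p) * (n : ℂ) ^ (-s)) ^ 20‖ :=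
        (norm_pow _ 20).symm
    _ = ‖∑ n ∈ Icc 1 ⌊b⌋₊, c n * (n : ℂ) ^ z‖ := by rw [hpow]
    _ ≤ L ^ (4 / 5 : ℝ) * ‖X b‖ + L ^ (406 : ℝ) * ∫ y in (1 : ℝ)..b, ‖X y‖ / y := key
    _ ≤ L ^ (406 : ℝ) * ‖X b‖ + L ^ (406 : ℝ) * ∫ y in (1 : ℝ)..b, ‖X y‖ / y := by
        gcongr
    _ = L ^ 406 * (‖X b‖ + ∫ y in (1 : ℝ)..b, ‖X y‖ / y) := by rw [h406]; ring

/-- `D ≥ ⌈e³²⌉` gives `𝓛 ≥ 32`. [cite: Zhang2022LandauSiegel, §2 (2.1)] -/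
private theorem ell_ge_32 {D : ℕ} (hD : ⌈Real.exp 32⌉₊ ≤ D) : 32 ≤ ell D := by
  have hexp : Real.exp 32 ≤ D := le_trans (Nat.le_ceil _) (by exact_mod_cast hD)
  have hD0 : (0 : ℝ) < D := lt_of_lt_of_le (Real.exp_pos 32) hexp
  exact (Real.le_log_iff_exp_le hD0).mpr hexp

/-- **Z22:§4.u005 HOLDS (for `F`)** [Z22 p.16, tex L917] «Hence, by partial integration,
`|F(s,ψ)|²⁰ ≪ 1 + 𝓛⁴⁰⁶(|X₁(D⁸⁰,ψ)| + ∫₁^{D⁸⁰} |X₁(x,ψ)|x⁻¹dx)`» for `s ∈ Ω₁` and EVERY `ψ ∈ Ψ`: the node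
`Section4.F20Bound`, PROVED with `C = 1`, threshold `D ≥ ⌈e³²⌉` (`norm_pow_twenty_le` with `a = ν`,
`X = X₁(·,ψ)`). [cite: Zhang2022LandauSiegel, §4 Lemma 4.1 (proof) p.16] -/
theorem f20Bound_holds : F20Bound := by
  refine ⟨1, ⌈Real.exp 32⌉₊, fun D _ χ hD _ _ x s hs => ?_⟩
  have h := norm_pow_twenty_le (ell_ge_32 hD) x.ψ (nu χ) hs (X1 χ x) (fun y => rfl)
  rw [one_mul]
  exact h.trans (le_add_of_nonneg_left zero_le_one)

/-- **Z22:§4.u005 HOLDS (for `G`)** [Z22 p.16, tex L919] «For `G(s,ψ)` an entirely analogous bound is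
valid»: `|G(s,ψ)|²⁰ ≤ 1 + 𝓛⁴⁰⁶(|X₂(D⁸⁰,ψ)| + ∫₁^{D⁸⁰} |X₂(x,ψ)|x⁻¹dx)` for `s ∈ Ω₁`, every `ψ ∈ Ψ` — the
node `Section4.G20Bound`, PROVED with `C = 1`, threshold `D ≥ ⌈e³²⌉` (`norm_pow_twenty_le` with `a = υ`,
`X = X₂(·,ψ)`). [cite: Zhang2022LandauSiegel, §4 Lemma 4.1 (proof) p.16] -/
theorem g20Bound_holds : G20Bound := by
  refine ⟨1, ⌈Real.exp 32⌉₊, fun D _ χ hD _ _ x s hs => ?_⟩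
  have h := norm_pow_twenty_le (ell_ge_32 hD) x.ψ (ups χ) hs (X2 χ x) (fun y => rfl)
  rw [one_mul]
  exact h.trans (le_add_of_nonneg_left zero_le_one)

/-! ## Z22:Lem4.1.pf — "The result now follows by (3.4)" -/

/-- Twentieth roots with a constant: `‖F‖²⁰ ≤ K·L¹⁵⁷⁷`, `K ≥ 0`, `L > 0` ⇒
`‖F‖ ≤ K^{1/20}·L^{1577/20}`. [cite: Zhang2022LandauSiegel, §4 Lemma 4.1 (proof) p.16] -/
private theorem norm_le_of_pow_twenty_le {F : ℂ} {K L : ℝ} (hK : 0 ≤ K) (hL : 0 < L)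
    (h : ‖F‖ ^ 20 ≤ K * L ^ (1577 : ℕ)) :
    ‖F‖ ≤ K ^ ((20 : ℕ)⁻¹ : ℝ) * L ^ ((1577 : ℝ) / 20) := by
  have h1 : (‖F‖ ^ 20) ^ ((20 : ℕ)⁻¹ : ℝ) = ‖F‖ :=
    Real.pow_rpow_inv_natCast (norm_nonneg F) (by norm_num)
  have h2 : (‖F‖ ^ 20) ^ ((20 : ℕ)⁻¹ : ℝ) ≤ (K * L ^ (1577 : ℕ)) ^ ((20 : ℕ)⁻¹ : ℝ) :=
    Real.rpow_le_rpow (by positivity) h (by positivity)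
  rw [h1, Real.mul_rpow hK (by positivity), ← Real.rpow_natCast L 1577,
    ← Real.rpow_mul hL.le] at h2
  convert h2 using 2
  norm_num

/-- **Z22:Lem4.1.pf HOLDS as a genuine edge** [Z22 p.16, tex L919–L921] «The result now follows by
(3.4)»: the node `Section4.Ded41 := F20Bound → G20Bound → Skeleton.Lemma41`. From the antecedents with
their constants `C_F, C_G` (enlarged to `C′ = max C 1`) and `ψ ∈ Ψ₁`, (3.4) (= `Skeleton.Ineq34`, part of
the definition of `Ψ₁`; the integral split by `Lemma36.intervalIntegrable_natFloor_div`) bounds each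
bracket by `𝓛¹¹⁷¹`, so `|F|²⁰ ≤ C_F′(1 + 𝓛¹⁵⁷⁷) ≤ 2C_F′𝓛¹⁵⁷⁷` and `|F| ≤ (2C_F′)^{1/20}𝓛^{1577/20} ≤
(2C_F′)^{1/20}𝓛⁷⁹` (`78.85 < 79`); likewise `G`. Constant of Lemma 4.1 obtained:
`(2C_F′)^{1/20} + (2C_G′)^{1/20}`. [cite: Zhang2022LandauSiegel, §4 Lemma 4.1 (proof) p.16] -/
theorem ded41_holds : Ded41 := by
  intro hF hG
  obtain ⟨CF, hF⟩ := hF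
  obtain ⟨CG, hG⟩ := hG
  set KF : ℝ := max CF 1 with hKFdef
  set KG : ℝ := max CG 1 with hKGdef
  have hKF1 : 1 ≤ KF := le_max_right CF 1
  have hKG1 : 1 ≤ KG := le_max_right CG 1
  have hKF0 : 0 ≤ 2 * KF := by linarith
  have hKG0 : 0 ≤ 2 * KG := by linarith
  refine ⟨(2 * KF) ^ ((20 : ℕ)⁻¹ : ℝ) + (2 * KG) ^ ((20 : ℕ)⁻¹ : ℝ),
    ((hF.and hG).and (forAllLarge_le_ell₁ 1)).mono ?_⟩
  intro D _ χ _ _ h x hx s hs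
  obtain ⟨⟨hF, hG⟩, hL1⟩ := h
  have hL0 : 0 < ell D := by linarith
  set L : ℝ := ell D with hLdef
  -- `𝓛 ≥ 1` forces `D ≥ e > 1`
  have hD1 : (1 : ℝ) ≤ D := by
    by_contra hcon
    push Not at hcon
    have h' : Real.log (D : ℝ) ≤ 0 := Real.log_nonpos (Nat.cast_nonneg D) hcon.le
    have : L = Real.log (D : ℝ) := by rw [hLdef, ell]
    linarith
  -- (3.4) for `ψ ∈ Ψ₁`, split into the `X₁`- and `X₂`-brackets
  obtain ⟨h34, -, -⟩ := hx
  set b : ℝ := (D : ℝ) ^ 80 with hbdef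
  have hb1 : 1 ≤ b := one_le_pow₀ hD1
  have hI1 : IntervalIntegrable (fun y : ℝ => ‖X1 χ x y‖ / y) volume 1 b :=
    Lemma36.intervalIntegrable_natFloor_div
      (fun N => ‖∑ n ∈ Icc 1 N, nu20 χ n * x.ψ (n : ZMod x.p) * (n : ℂ) ^ (-s0 D)‖) one_pos hb1
  have hI2 : IntervalIntegrable (fun y : ℝ => ‖X2 χ x y‖ / y) volume 1 b :=
    Lemma36.intervalIntegrable_natFloor_div
      (fun N => ‖∑ n ∈ Icc 1 N, ups20 χ n * x.ψ (n : ZMod x.p) * (n : ℂ) ^ (-s0 D)‖) one_pos hb1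
  have hsplit : ∫ y in (1 : ℝ)..b, (‖X1 χ x y‖ + ‖X2 χ x y‖) / y =
      (∫ y in (1 : ℝ)..b, ‖X1 χ x y‖ / y) + ∫ y in (1 : ℝ)..b, ‖X2 χ x y‖ / y := by
    simp_rw [add_div]
    exact intervalIntegral.integral_add hI1 hI2
  have hI1n : 0 ≤ ∫ y in (1 : ℝ)..b, ‖X1 χ x y‖ / y :=
    intervalIntegral.integral_nonneg hb1 fun y hy => div_nonneg (norm_nonneg _) (by linarith [hy.1])
  have hI2n : 0 ≤ ∫ y in (1 : ℝ)..b, ‖X2 χ x y‖ / y :=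
    intervalIntegral.integral_nonneg hb1 fun y hy => div_nonneg (norm_nonneg _) (by linarith [hy.1])
  have h34' : ‖X1 χ x b‖ + ‖X2 χ x b‖ +
      ((∫ y in (1 : ℝ)..b, ‖X1 χ x y‖ / y) + ∫ y in (1 : ℝ)..b, ‖X2 χ x y‖ / y) < L ^ 1171 := by
    rw [← hsplit]
    exact h34
  set E1 : ℝ := ‖X1 χ x b‖ + ∫ y in (1 : ℝ)..b, ‖X1 χ x y‖ / y with hE1def
  set E2 : ℝ := ‖X2 χ x b‖ + ∫ y in (1 : ℝ)..b, ‖X2 χ x y‖ / y with hE2def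
  have hE10 : 0 ≤ E1 := by rw [hE1def]; exact add_nonneg (norm_nonneg _) hI1n
  have hE20 : 0 ≤ E2 := by rw [hE2def]; exact add_nonneg (norm_nonneg _) hI2n
  have hE1 : E1 ≤ L ^ 1171 := by
    have := norm_nonneg (X2 χ x b)
    rw [hE1def]; linarith
  have hE2 : E2 ≤ L ^ 1171 := by
    have := norm_nonneg (X1 χ x b)
    rw [hE2def]; linarith
  -- the antecedents at this `D, ψ, s`
  have hF' : ‖Fpoly χ x s‖ ^ 20 ≤ CF * (1 + L ^ 406 * E1) := hF x s hs
  have hG' : ‖Gpoly χ x s‖ ^ 20 ≤ CG * (1 + L ^ 406 * E2) := hG x s hs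
  have hpow1577 : L ^ 406 * L ^ 1171 = L ^ (1577 : ℕ) := by rw [← pow_add]
  have hL1577 : 1 ≤ L ^ (1577 : ℕ) := one_le_pow₀ hL1
  have hL406 : 0 ≤ L ^ 406 := pow_nonneg hL0.le _
  have hbrF : 1 + L ^ 406 * E1 ≤ 2 * L ^ (1577 : ℕ) := by
    have : L ^ 406 * E1 ≤ L ^ 406 * L ^ 1171 := mul_le_mul_of_nonneg_left hE1 hL406
    linarith
  have hbrG : 1 + L ^ 406 * E2 ≤ 2 * L ^ (1577 : ℕ) := by
    have : L ^ 406 * E2 ≤ L ^ 406 * L ^ 1171 := mul_le_mul_of_nonneg_left hE2 hL406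
    linarith
  have hbr0F : 0 ≤ 1 + L ^ 406 * E1 := by
    have := mul_nonneg hL406 hE10; linarith
  have hbr0G : 0 ≤ 1 + L ^ 406 * E2 := by
    have := mul_nonneg hL406 hE20; linarith
  have hF20 : ‖Fpoly χ x s‖ ^ 20 ≤ 2 * KF * L ^ (1577 : ℕ) :=
    calc ‖Fpoly χ x s‖ ^ 20 ≤ CF * (1 + L ^ 406 * E1) := hF'
      _ ≤ KF * (1 + L ^ 406 * E1) := mul_le_mul_of_nonneg_right (le_max_left _ _) hbr0F
      _ ≤ KF * (2 * L ^ (1577 : ℕ)) := mul_le_mul_of_nonneg_left hbrF (by linarith)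
      _ = 2 * KF * L ^ (1577 : ℕ) := by ring
  have hG20 : ‖Gpoly χ x s‖ ^ 20 ≤ 2 * KG * L ^ (1577 : ℕ) :=
    calc ‖Gpoly χ x s‖ ^ 20 ≤ CG * (1 + L ^ 406 * E2) := hG'
      _ ≤ KG * (1 + L ^ 406 * E2) := mul_le_mul_of_nonneg_right (le_max_left _ _) hbr0G
      _ ≤ KG * (2 * L ^ (1577 : ℕ)) := mul_le_mul_of_nonneg_left hbrG (by linarith)
      _ = 2 * KG * L ^ (1577 : ℕ) := by ring
  have hFr := norm_le_of_pow_twenty_le hKF0 hL0 hF20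
  have hGr := norm_le_of_pow_twenty_le hKG0 hL0 hG20
  -- `1577/20 < 79`
  have h79 : L ^ ((1577 : ℝ) / 20) ≤ L ^ (79 : ℕ) := by
    rw [← Real.rpow_natCast]
    exact Real.rpow_le_rpow_of_exponent_le hL1 (by norm_num)
  have hA0 : 0 ≤ (2 * KF) ^ ((20 : ℕ)⁻¹ : ℝ) := Real.rpow_nonneg hKF0 _
  have hB0 : 0 ≤ (2 * KG) ^ ((20 : ℕ)⁻¹ : ℝ) := Real.rpow_nonneg hKG0 _
  calc ‖Fpoly χ x s‖ + ‖Gpoly χ x s‖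
      ≤ (2 * KF) ^ ((20 : ℕ)⁻¹ : ℝ) * L ^ ((1577 : ℝ) / 20)
          + (2 * KG) ^ ((20 : ℕ)⁻¹ : ℝ) * L ^ ((1577 : ℝ) / 20) := add_le_add hFr hGr
    _ ≤ (2 * KF) ^ ((20 : ℕ)⁻¹ : ℝ) * L ^ (79 : ℕ) + (2 * KG) ^ ((20 : ℕ)⁻¹ : ℝ) * L ^ (79 : ℕ) :=
        add_le_add (mul_le_mul_of_nonneg_left h79 hA0) (mul_le_mul_of_nonneg_left h79 hB0)
    _ = ((2 * KF) ^ ((20 : ℕ)⁻¹ : ℝ) + (2 * KG) ^ ((20 : ℕ)⁻¹ : ℝ)) * L ^ 79 := by ring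

end Literature.NumberTheory.LFunctions.Zhang2022.Section4

end
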